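import Mathlib.Analysis.Calculus.Deriv.MeanValue
import Mathlib.Analysis.SpecialFunctions.ExpDeriv
import Literature.Analysis.FunctionSpaces.TorusLinearisedFormTruncation
import Literature.Analysis.FunctionSpaces.TorusClassicalNSUniqueness
import HarnessLib

/-!
# Solo salvage for claim C172 `Belanger2026` (cell `ns-claims`, D-0090): the rigidity face for
# classical mean-zero ancient solutions on the fixed torus, kernel

Claim of record: C172 `Belanger2026` (Zenodo 21046255, v2.1.2, 60 pp.), Theorem 1.1 p. 7 l. 3–7,
sentence 1: «there exists no nontrivial bounded ancient suitable weak solution of the unforced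
Navier–Stokes equations on the fixed torus T³ × (−∞, 0]» over Definition 3.1 p. 13 l. 54–71
(divergence-free, ZERO SPATIAL MEAN, `sup_{t≤0} ‖u(t)‖_∞ < ∞`, …). This file (seat
`ns-claims-salvage-p3` g5, records-grade, off the verdict — the token is the refuter's) proves the
CLASSICAL face of that sentence against the tree's torus vocabulary
(`Torus.IsClassicalNSSolutionOn`, `Torus.kineticEnergy`, `Torus.gradNormSq`, `Torus.HasZeroMean`),
by exactly the three ingredients the text itself prints (Lemma 3.2 p. 14 `Ė = −νΩ`; Lemma 13.12
(20) p. 34 torus Poincaré for mean-zero fields; Lemma 9.1 p. 25 energy ceiling):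

* `kineticEnergy_antitone_weighted` — for a classical solution of unforced Navier–Stokes with
  `ν ≥ 0` on the time ray `(−∞, T]` of the UNIT torus `ℝ^d/ℤ^d` with mean-zero slices,
  `t ↦ E(u(t)) · e^{8π²ν t}` is non-increasing (energy balance `E' = −ν‖∇u‖₂²` of
  `Torus.IsClassicalNSSolutionOn.energy_balance_holds` + Poincaré `4π² ∫‖u‖² ≤ ‖∇u‖₂²` of
  `Torus.four_pi_sq_mul_integral_norm_sq_le_gradNormSq`, i.e. `E' ≤ −8π²ν E`);
* `ancient_meanZero_eq_zero_of_kineticEnergy_le` — **rigidity**: if moreover `ν > 0` and the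
  kinetic energy is bounded on `(−∞, T]`, then `u(t) = 0` for every `t ≤ T` (backward growth
  `E(s) ≥ E(t) e^{8π²ν (t − s)}` against the ceiling, `s → −∞`);
* `kineticEnergy_le_of_norm_le` / `ancient_meanZero_eq_zero_of_norm_le` — the same under the
  printed hypothesis (6) `‖u(x,t)‖ ≤ M_u` (Lemma 9.1's face `E ≤ ½ M_u²·|T^d|`, `|T^d| = 1` here).

So sentence 1 of Theorem 1.1 restricted to classical solutions is a TRUE classical statement (any
dimension `d`, unit period; the printed `(ℝ/2πℤ)³` changes only the rate `8π²ν ↦ 2ν`); the load of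
the printed «Equivalently … remains smooth for all t > 0» sits in the reduction §4 (Prop. 4.2,
Object B), which this file does not touch (refuter's object).
Solo lane (`Theorems/SoloSalvage<Slug>.lean`, no item); records-grade, no token effect.

WHAT THIS IS NOT: not a claim about NS regularity or blow-up; not a claim about any author beyond the
typed locator.
-/

noncomputable section

set_option linter.dupNamespace false

open Set MeasureTheory Filter Topology
open scoped InnerProductSpace

namespace Summit.NavierStokesRegularity.NavierStokesRegularity.Theorems.Belanger2026Salvage

open Literature.Analysis.FunctionSpaces Literature.Analysis.FunctionSpaces.Torus

variable {d : Type*} [Fintype d] [DecidableEq d]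

/-- **Energy balance + Poincaré**: for a classical solution of the unforced Navier–Stokes system with
`ν ≥ 0` on the convex time set `S` whose slices have zero mean, the kinetic energy has one-sided
derivative `−ν‖∇u(t)‖₂² ≤ −8π²ν·E(u(t))` within `S`. (Lemma 3.2 `Ė = −νΩ` + Lemma 13.12 (20)
`E ≤ ½Ω` of the text, on the unit torus.) [cite: Belanger2026, Lemma 3.2 p.14; Lemma 13.12 (20) p.34 l.46–56] -/
theorem hasDerivWithinAt_kineticEnergy_le {S : Set ℝ} (hS : Convex ℝ S) {ν : ℝ} (hν : 0 ≤ ν)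
    {u : ℝ → UnitAddTorus d → EuclideanSpace ℝ d} {p : ℝ → UnitAddTorus d → ℝ}
    (h : IsClassicalNSSolutionOn S ν 0 u p) (hmean : ∀ t ∈ S, HasZeroMean (u t))
    {t : ℝ} (ht : t ∈ S) :
    HasDerivWithinAt (fun s => kineticEnergy (u s)) (-ν * gradNormSq (u t)) S t ∧
      -ν * gradNormSq (u t) ≤ -(8 * Real.pi ^ 2 * ν) * kineticEnergy (u t) := by
  have hE := IsClassicalNSSolutionOn.energy_balance_holds h hS ht
  simp only [Pi.zero_apply, inner_zero_left, integral_zero, add_zero] at hE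
  refine ⟨hE, ?_⟩
  have hP := four_pi_sq_mul_integral_norm_sq_le_gradNormSq (h.smooth_velocity.isSmooth_slice ht)
    (hmean t ht)
  unfold kineticEnergy
  nlinarith [hP, hν]

/-- **Weighted monotonicity**: under the hypotheses of `hasDerivWithinAt_kineticEnergy_le` on the
time ray `S = (−∞, T]`, the function `t ↦ E(u(t))·e^{8π²ν t}` is non-increasing on `(−∞, T]`
(its one-sided derivative is `(E' + 8π²ν E)e^{8π²ν t} ≤ 0`). [folklore] -/
theorem kineticEnergy_antitone_weighted {T ν : ℝ} (hν : 0 ≤ ν)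
    {u : ℝ → UnitAddTorus d → EuclideanSpace ℝ d} {p : ℝ → UnitAddTorus d → ℝ}
    (h : IsClassicalNSSolutionOn (Iic T) ν 0 u p) (hmean : ∀ t ∈ Iic T, HasZeroMean (u t)) :
    AntitoneOn (fun t => kineticEnergy (u t) * Real.exp ((8 * Real.pi ^ 2 * ν) * t)) (Iic T) := by
  set E : ℝ → ℝ := fun t => kineticEnergy (u t) with hEdef
  -- derivative of the weighted energy within `Iic T`
  have hF : ∀ t ∈ Iic T, HasDerivWithinAt (fun s => E s * Real.exp ((8 * Real.pi ^ 2 * ν) * s))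
      ((-ν * gradNormSq (u t)) * Real.exp ((8 * Real.pi ^ 2 * ν) * t) +
        E t * (Real.exp ((8 * Real.pi ^ 2 * ν) * t) * (8 * Real.pi ^ 2 * ν))) (Iic T) t := by
    intro t ht
    have h1 := (hasDerivWithinAt_kineticEnergy_le (convex_Iic T) hν h hmean ht).1
    have h2 : HasDerivWithinAt (fun s => Real.exp ((8 * Real.pi ^ 2 * ν) * s)) (Real.exp ((8 * Real.pi ^ 2 * ν) * t) * (8 * Real.pi ^ 2 * ν))
        (Iic T) t := by
      have := ((hasDerivAt_id t).const_mul ((8 * Real.pi ^ 2 * ν))).exp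
      simp only [mul_one] at this
      exact this.hasDerivWithinAt
    exact h1.mul h2
  have hcont : ContinuousOn (fun s => E s * Real.exp ((8 * Real.pi ^ 2 * ν) * s)) (Iic T) := fun t ht =>
    (hF t ht).continuousWithinAt
  refine antitoneOn_of_hasDerivWithinAt_nonpos (convex_Iic T) hcont
    (f' := fun t => (-ν * gradNormSq (u t)) * Real.exp ((8 * Real.pi ^ 2 * ν) * t) +
        E t * (Real.exp ((8 * Real.pi ^ 2 * ν) * t) * (8 * Real.pi ^ 2 * ν))) ?_ ?_
  · intro t ht
    rw [interior_Iic] at ht ⊢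
    exact ((hF t (mem_Iic.2 (le_of_lt ht))).mono Iio_subset_Iic_self)
  · intro t ht
    rw [interior_Iic] at ht
    have h2 := (hasDerivWithinAt_kineticEnergy_le (convex_Iic T) hν h hmean
      (mem_Iic.2 (le_of_lt ht))).2
    have hexp : 0 < Real.exp ((8 * Real.pi ^ 2 * ν) * t) := Real.exp_pos _
    have : (-ν * gradNormSq (u t)) * Real.exp ((8 * Real.pi ^ 2 * ν) * t) + E t * (Real.exp ((8 * Real.pi ^ 2 * ν) * t) * (8 * Real.pi ^ 2 * ν))
        = (-ν * gradNormSq (u t) + (8 * Real.pi ^ 2 * ν) * E t) * Real.exp ((8 * Real.pi ^ 2 * ν) * t) := by ring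
    rw [this]
    exact mul_nonpos_of_nonpos_of_nonneg (by simp only [hEdef] at h2 ⊢; linarith) hexp.le

/-- **Backward growth of the energy**: for `s ≤ t ≤ T`,
`E(u(t)) · e^{8π²ν (t − s)} ≤ E(u(s))`. [folklore] -/
theorem kineticEnergy_mul_exp_le {T ν : ℝ} (hν : 0 ≤ ν)
    {u : ℝ → UnitAddTorus d → EuclideanSpace ℝ d} {p : ℝ → UnitAddTorus d → ℝ}
    (h : IsClassicalNSSolutionOn (Iic T) ν 0 u p) (hmean : ∀ t ∈ Iic T, HasZeroMean (u t))
    {s t : ℝ} (hst : s ≤ t) (ht : t ≤ T) :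
    kineticEnergy (u t) * Real.exp ((8 * Real.pi ^ 2 * ν) * (t - s)) ≤ kineticEnergy (u s) := by
  have hmono := kineticEnergy_antitone_weighted hν h hmean (show s ∈ Iic T from hst.trans ht)
    (show t ∈ Iic T from ht) hst
  simp only at hmono
  have hexp : 0 < Real.exp ((8 * Real.pi ^ 2 * ν) * s) := Real.exp_pos _
  rw [show (8 * Real.pi ^ 2 * ν) * (t - s) = (8 * Real.pi ^ 2 * ν) * t - (8 * Real.pi ^ 2 * ν) * s by ring, Real.exp_sub, mul_div_assoc']
  rwa [div_le_iff₀ hexp]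

/-- **Rigidity (Liouville) for classical mean-zero ancient solutions on the fixed torus with bounded
energy**: a classical solution of the unforced Navier–Stokes system with `ν > 0` on
`ℝ^d/ℤ^d × (−∞, T]` whose slices have zero mean and whose kinetic energy is bounded on `(−∞, T]`
vanishes identically. (The classical face of Theorem 1.1 sentence 1 / Theorem 13.10 of the text:
`E(s) ≥ E(t)e^{8π²ν(t−s)} → ∞` as `s → −∞` unless `E(t) = 0`.)
[cite: Belanger2026, Thm 1.1 p.7 l.3–7; Thm 13.10 p.33 l.44–46; Lemma 13.12 p.34 l.46–56] -/
theorem ancient_meanZero_eq_zero_of_kineticEnergy_le {T ν : ℝ} (hν : 0 < ν)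
    {u : ℝ → UnitAddTorus d → EuclideanSpace ℝ d} {p : ℝ → UnitAddTorus d → ℝ}
    (h : IsClassicalNSSolutionOn (Iic T) ν 0 u p) (hmean : ∀ t ∈ Iic T, HasZeroMean (u t))
    {B : ℝ} (hB : ∀ t ∈ Iic T, kineticEnergy (u t) ≤ B) :
    ∀ t ∈ Iic T, u t = 0 := by
  intro t ht
  have hrate : 0 < (8 * Real.pi ^ 2 * ν) := by positivity
  -- `E(t) ≤ B e^{-rate (t - s)}` for every `s ≤ t`
  have hbound : ∀ s ≤ t, kineticEnergy (u t) ≤ B * Real.exp (-((8 * Real.pi ^ 2 * ν) * (t - s))) := by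
    intro s hs
    have h1 := kineticEnergy_mul_exp_le hν.le h hmean hs ht
    have hexp : 0 < Real.exp ((8 * Real.pi ^ 2 * ν) * (t - s)) := Real.exp_pos _
    rw [Real.exp_neg, ← div_eq_mul_inv, le_div_iff₀ hexp]
    exact h1.trans (hB s (hs.trans ht))
  -- the right-hand side tends to `0` as `s → -∞`
  have hlim : Tendsto (fun s => B * Real.exp (-((8 * Real.pi ^ 2 * ν) * (t - s)))) atBot (𝓝 0) := by
    have h1 : Tendsto (fun s => -((8 * Real.pi ^ 2 * ν) * (t - s))) atBot atBot := by
      have : (fun s => -((8 * Real.pi ^ 2 * ν) * (t - s))) = fun s => (8 * Real.pi ^ 2 * ν) * s + -((8 * Real.pi ^ 2 * ν) * t) := by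
        funext s; ring
      rw [this]
      exact tendsto_atBot_add_const_right _ _ (Tendsto.const_mul_atBot hrate tendsto_id)
    have h2 := Real.tendsto_exp_atBot.comp h1
    simpa using h2.const_mul B
  have hle : kineticEnergy (u t) ≤ 0 :=
    ge_of_tendsto hlim (eventually_atBot.2 ⟨t, fun s hs => hbound s hs⟩)
  have hint : ∫ x, ‖u t x‖ ^ 2 ≤ 0 := by
    unfold kineticEnergy at hle
    linarith
  exact eq_zero_of_integral_norm_sq_nonpos (h.smooth_velocity.isSmooth_slice ht) hint

omit [DecidableEq d] in
/-- **Energy ceiling** (Lemma 9.1's face on the unit torus, `|T^d| = 1`): a smooth field with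
`‖v(x)‖ ≤ M` everywhere has `E(v) ≤ ½ M²`. [cite: Belanger2026, Lemma 9.1 p.25 l.50–70] -/
theorem kineticEnergy_le_of_norm_le {v : UnitAddTorus d → EuclideanSpace ℝ d} (hv : IsSmooth v)
    {M : ℝ} (hM : ∀ x, ‖v x‖ ≤ M) : kineticEnergy v ≤ 2⁻¹ * M ^ 2 := by
  unfold kineticEnergy
  refine mul_le_mul_of_nonneg_left ?_ (by norm_num)
  have hM0 : 0 ≤ M := (norm_nonneg _).trans (hM 0)
  calc ∫ x, ‖v x‖ ^ 2 ≤ ∫ _x : UnitAddTorus d, M ^ 2 :=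
        integral_mono hv.norm_sq.integrable (integrable_const _) fun x =>
          pow_le_pow_left₀ (norm_nonneg _) (hM x) 2
    _ = M ^ 2 := by simp

/-- **Rigidity under the printed bound (6)**: a classical solution of the unforced Navier–Stokes
system with `ν > 0` on `ℝ^d/ℤ^d × (−∞, T]` with mean-zero slices and `‖u(x,t)‖ ≤ M_u` for all
`t ≤ T`, `x`, vanishes identically — «no nontrivial bounded ancient (classical, mean-zero) solution
on the fixed torus». The vorticity bound `M` of (6), suitability and the whole closure chain
§§5–13 are not needed. [cite: Belanger2026, Thm 1.1 p.7 l.3–7; Def 3.1 (6) p.13 l.59–63; Thm 13.10 p.33 l.44–46] -/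
theorem ancient_meanZero_eq_zero_of_norm_le {T ν : ℝ} (hν : 0 < ν)
    {u : ℝ → UnitAddTorus d → EuclideanSpace ℝ d} {p : ℝ → UnitAddTorus d → ℝ}
    (h : IsClassicalNSSolutionOn (Iic T) ν 0 u p) (hmean : ∀ t ∈ Iic T, HasZeroMean (u t))
    {Mu : ℝ} (hMu : ∀ t ∈ Iic T, ∀ x, ‖u t x‖ ≤ Mu) :
    ∀ t ∈ Iic T, u t = 0 :=
  ancient_meanZero_eq_zero_of_kineticEnergy_le hν h hmean (B := 2⁻¹ * Mu ^ 2) fun t ht =>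
    kineticEnergy_le_of_norm_le (h.smooth_velocity.isSmooth_slice ht) (hMu t ht)

end Summit.NavierStokesRegularity.NavierStokesRegularity.Theorems.Belanger2026Salvage

end
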